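import Literature.NumberTheory.DiophantineGeometry.PlaneSectionAveragingEstimateProofs
import Literature.NumberTheory.DiophantineGeometry.PlaneCurvePointCountFinalProofs
import HarnessLib

/-!
# The refined averaging estimate for an absolutely irreducible hypersurface
(Cafure–Matera 2006, §4 and §5.1 (21)–(22), with the grading by the degree of a small factor)

Library file (theorems only), continuing `PlaneSectionAveragingEstimateProofs`. Let `K = 𝔽_q`,
`f ∈ K[x₀, …, xₘ]` (`m ≥ 1`) absolutely irreducible of total degree `δ ≥ 2`, `δ < q`, and for a
parameter `p = (ν, ω, η)` let `f_p` be the plane section, `N_p` its number of zeros in `K²` and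
`F_p` its image in `K̄[x₀, x₁]`. Cafure–Matera grade the sections that are not absolutely
irreducible by the number `ν(L)` of absolutely irreducible `𝔽_q`-factors and observe that a section
in the `j`-th class has an absolutely irreducible factor of degree `≤ D_j = ⌊δ/(j+1)⌋` (§4). Here the
grading is done directly by small factors: say `p` is **`D`-bad** when it is not the case that
`f_p` is non-constant and every divisor of `F_p` of total degree `≤ D` is a unit. Then

* `abs_sub_le_of_not_irreducible` (one section, the heart of the matter): if `f_p` is non-constant
  and `F_p` is reducible, `|N_p - q| ≤ W + q · #{j ∈ [1, δ-1] : F_p has a non-unit divisor of total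
  degree ≤ ⌊δ/(j+1)⌋}` with `W = (δ-1)(δ-2)√q + 1 + δ + 4δ³` — the upper bound by the factor-by-factor
  Weil estimate `N_p ≤ m_p q + (δ-1)(δ-2)√q + δ³` of `PlaneCurvePointCountFinalProofs` (`m_p` the
  number of distinct `K`-irreducible factors, and `m_p - 1 ≤ #{j : …}` because the `K`-factor of
  least degree has degree `≤ δ/m_p`), the lower bound `-q` because a reducible `F_p` has a non-unit
  divisor of degree `≤ δ/2`;
* `abs_sub_le_planeSection_graded`: for every parameter,
  `|N_p - q| ≤ W + [f_p = 0] q² + q · #{j ∈ [1, δ-1] : p is not abs. irreducible and ⌊δ/(j+1)⌋-bad}`;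
* `mul_abs_sub_le_graded` (**the refined form of (21)–(22)**): summing over the parameters with
  `η ≠ 0`, `q^{m+2}(qᵐ - 1)|N - qᵐ| ≤ qᵐ(qᵐ - 1)q^{m+1} W + δ² q^{3m+1} + q ∑_{j=1}^{δ-1} B_j`, where
  `B_j` is the number of parameters that are not absolutely irreducible and `⌊δ/(j+1)⌋`-bad.

The counts `B_j ≤ min(Cor. 3.2, Cor. 3.4 with D = ⌊δ/(j+1)⌋) q^{3m}` are inserted in the final
assembly of Thm. 5.2.

## References

* A. Cafure, G. Matera, *Improved explicit estimates on the number of solutions of equations over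
  a finite field*, Finite Fields Appl. 12 (2006) 155–185, §4 (the classes `Π_j`), Lemma 5.1,
  §5.1 (21)–(22). [CafureMatera2006]
-/

noncomputable section

open scoped Classical
open MvPolynomial Literature.RingTheory.MvPolynomial Polynomial.Bivariate

namespace Literature.NumberTheory.DiophantineGeometry

universe u

variable {K : Type u} [Field K]

/-! ### Non-units, total degree and divisors in `K[x₀, x₁]` -/

omit [Field K] in
/-- Over a field, a nonzero non-unit polynomial has positive total degree. [folklore] -/
theorem totalDegree_pos_of_not_isUnit {L : Type*} [Field L] {σ : Type*} {P : MvPolynomial σ L}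
    (hP0 : P ≠ 0) (hPu : ¬ IsUnit P) : 0 < P.totalDegree := by
  by_contra h
  rw [not_lt, Nat.le_zero, totalDegree_eq_zero_iff_eq_C] at h
  apply hPu
  rw [h]
  refine (IsUnit.mk0 _ fun h0 ↦ hP0 ?_).map MvPolynomial.C
  rw [h, h0, MvPolynomial.C_0]

omit [Field K] in
/-- A polynomial of positive total degree is not a unit. [folklore] -/
theorem not_isUnit_of_totalDegree_pos {L : Type*} [Field L] {σ : Type*} {P : MvPolynomial σ L}
    (hP : 0 < P.totalDegree) : ¬ IsUnit P := fun hu ↦ by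
  have := (MvPolynomial.isUnit_iff_totalDegree_of_isReduced.1 hu).2
  omega

/-- The sum of the total degrees of the members of a finset of nonzero polynomials over a field is
the total degree of their product. [folklore] -/
theorem sum_totalDegree_eq_totalDegree_prod {L : Type*} [Field L] {σ : Type*} {ι : Type*}
    (s : Finset ι) (g : ι → MvPolynomial σ L) (hg : ∀ i ∈ s, g i ≠ 0) :
    ∑ i ∈ s, (g i).totalDegree = (∏ i ∈ s, g i).totalDegree := by
  classical
  induction s using Finset.induction_on with
  | empty => simp
  | insert a s ha ih =>
    rw [Finset.sum_insert ha, Finset.prod_insert ha, totalDegree_mul_of_isDomain (hg a (by simp))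
      (Finset.prod_ne_zero_iff.2 fun i hi ↦ hg i (by simp [hi])), ih fun i hi ↦ hg i (by simp [hi])]

/-- The product of the distinct normalised irreducible factors divides. [folklore] -/
theorem prod_normalizedFactors_toFinset_dvd {α : Type*} [CommMonoidWithZero α]
    [NormalizationMonoid α] [UniqueFactorizationMonoid α] [DecidableEq α] {a : α} (ha : a ≠ 0) :
    (∏ u ∈ (UniqueFactorizationMonoid.normalizedFactors a).toFinset, u) ∣ a := by
  have h1 : (∏ u ∈ (UniqueFactorizationMonoid.normalizedFactors a).toFinset, u) ∣
      (UniqueFactorizationMonoid.normalizedFactors a).prod := by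
    rw [Finset.prod_eq_multiset_prod, Multiset.map_id', Multiset.toFinset_val]
    exact Multiset.prod_dvd_prod_of_le (Multiset.dedup_le _)
  exact h1.trans (UniqueFactorizationMonoid.prod_normalizedFactors ha).dvd

/-! ### One section that is not absolutely irreducible -/

section OneSection

variable [Fintype K]

/-- **The error of a reducible non-constant plane section, graded by small factors.** Let
`K = 𝔽_q`, `2 ≤ δ < q`, `g ∈ K[x₀, x₁]` of total degree `≤ δ` and positive, whose image `G` in
`K̄[x₀, x₁]` is not irreducible. Then
`|N(g) - q| ≤ W + q · #{j ∈ [1, δ-1] : G has a non-unit divisor of total degree ≤ ⌊δ/(j+1)⌋}`,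
`W = (δ-1)(δ-2)√q + 1 + δ + 4δ³`. Upper bound: `N(g) ≤ m q + (δ-1)(δ-2)√q + δ³` with `m` the number
of distinct irreducible factors of `g` in `K[X][Y]` (`PlaneShear.card_zeros_le_card_factors_mul_add`)
and `m - 1 ≤ #{j : …}` (the factor of least total degree `t` has `m t ≤ δ`); lower bound: a
reducible `G` has a non-unit divisor of degree `≤ δ/2`, so `j = 1` is counted.
[cite: CafureMatera2006, Lemma 5.1 and §4] -/
theorem abs_sub_le_of_not_irreducible {δ : ℕ} (hδ2 : 2 ≤ δ) {g : MvPolynomial (Fin 2) K}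
    (hdeg : g.totalDegree ≤ δ) (hpos : 0 < g.totalDegree)
    (hnirr : ¬ Irreducible (MvPolynomial.map (algebraMap K (AlgebraicClosure K)) g)) :
    |(rationalPointCount g : ℝ) - Fintype.card K| ≤
      (((δ - 1) * (δ - 2) : ℕ) * √(Fintype.card K : ℝ) + 1 + δ + 4 * (δ : ℝ) ^ 3) +
        Fintype.card K * (((Finset.Icc 1 (δ - 1)).filter fun j ↦
          ∃ H : MvPolynomial (Fin 2) (AlgebraicClosure K),
            H ∣ MvPolynomial.map (algebraMap K (AlgebraicClosure K)) g ∧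
              H.totalDegree ≤ δ / (j + 1) ∧ ¬ IsUnit H).card : ℝ) := by
  set Kb := AlgebraicClosure K
  set ι : K →+* Kb := algebraMap K Kb with hι
  set G := MvPolynomial.map ι g with hG
  set q : ℕ := Fintype.card K with hq
  set S : Finset ℕ := (Finset.Icc 1 (δ - 1)).filter fun j ↦
    ∃ H : MvPolynomial (Fin 2) Kb, H ∣ G ∧ H.totalDegree ≤ δ / (j + 1) ∧ ¬ IsUnit H with hS
  have hg0 : g ≠ 0 := fun h ↦ by rw [h, totalDegree_zero] at hpos; exact lt_irrefl _ hpos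
  have hGdeg : G.totalDegree = g.totalDegree := totalDegree_map_of_injective g ι.injective
  have hG0 : G ≠ 0 := fun h ↦ by
    rw [h, totalDegree_zero] at hGdeg; omega
  have hGu : ¬ IsUnit G := not_isUnit_of_totalDegree_pos (by omega)
  -- membership in `S` from a small non-unit divisor
  have hmemS : ∀ {j : ℕ}, 1 ≤ j → ∀ {H : MvPolynomial (Fin 2) Kb}, H ∣ G → ¬ IsUnit H →
      (j + 1) * H.totalDegree ≤ δ → j ∈ S := by
    intro j hj H hH hHu hjH
    have hHpos : 0 < H.totalDegree :=
      totalDegree_pos_of_not_isUnit (fun h0 ↦ hG0 (by obtain ⟨c, hc⟩ := hH; rw [hc, h0, zero_mul])) hHu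
    rw [hS, Finset.mem_filter, Finset.mem_Icc]
    refine ⟨⟨hj, ?_⟩, H, hH, ?_, hHu⟩
    · -- `j + 1 ≤ (j+1) t ≤ δ`
      have : j + 1 ≤ (j + 1) * H.totalDegree := Nat.le_mul_of_pos_right _ hHpos
      omega
    · rw [Nat.le_div_iff_mul_le (by omega), mul_comm]; exact hjH
  -- ### lower bound: `1 ∈ S`
  have h1S : 1 ∈ S := by
    have hred : ∃ A B : MvPolynomial (Fin 2) Kb, G = A * B ∧ ¬ IsUnit A ∧ ¬ IsUnit B := by
      by_contra hno
      refine hnirr ⟨hGu, fun A B hAB ↦ ?_⟩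
      by_contra h
      rw [not_or] at h
      exact hno ⟨A, B, hAB, h.1, h.2⟩
    obtain ⟨A, B, hAB, hAu, hBu⟩ := hred
    have hA0 : A ≠ 0 := fun h ↦ hG0 (by rw [hAB, h, zero_mul])
    have hB0 : B ≠ 0 := fun h ↦ hG0 (by rw [hAB, h, mul_zero])
    have hsum : A.totalDegree + B.totalDegree ≤ δ := by
      rw [← totalDegree_mul_of_isDomain hA0 hB0, ← hAB, hGdeg]; exact hdeg
    rcases le_or_gt A.totalDegree B.totalDegree with hle | hlt
    · exact hmemS le_rfl ⟨B, hAB⟩ hAu (by omega)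
    · exact hmemS le_rfl ⟨A, by rw [hAB, mul_comm]⟩ hBu (by omega)
  have hScard : 1 ≤ S.card := Finset.card_pos.2 ⟨1, h1S⟩
  -- ### upper bound through `K[X][Y]`
  set P : Polynomial (Polynomial K) := (equivMvPolynomial K).symm g with hP
  have hPg : equivMvPolynomial K P = g := by rw [hP, AlgEquiv.apply_symm_apply]
  have hP0 : P ≠ 0 := by
    rw [hP]; exact (EmbeddingLike.map_ne_zero_iff).2 hg0
  have hTD : ∀ k j, δ < j + k → (P.coeff k).coeff j = 0 := fun k j hjk ↦ by
    rw [hP]; exact Dioph.coeff_coeff_symm_eq_zero g (by omega)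
  set m : ℕ := (UniqueFactorizationMonoid.normalizedFactors P).toFinset.card with hm
  have hup : (rationalPointCount g : ℝ) ≤ m * (q : ℝ) + ((δ - 1) * (δ - 2) : ℕ) * √(q : ℝ) +
      (δ : ℝ) ^ 3 := by
    have h2 := PlaneShear.card_zeros_le_card_factors_mul_add (K := K) (by omega) hP0 hTD
    rw [PlaneShear.card_filter_evalEval_eq_rationalPointCount P, hPg] at h2
    exact h2
  -- `m ≤ #S + 1`: the factor of least total degree
  have hmS : m ≤ S.card + 1 := by
    set T : Polynomial (Polynomial K) → ℕ := fun u ↦ (equivMvPolynomial K u).totalDegree with hT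
    set nf := (UniqueFactorizationMonoid.normalizedFactors P).toFinset with hnf
    by_cases hm0 : m = 0
    · omega
    have hne : nf.Nonempty := Finset.card_pos.1 (by rw [← hm]; omega)
    obtain ⟨u₀, hu₀, hmin⟩ := Finset.exists_min_image nf T hne
    -- every member of `nf` is irreducible, nonzero, and a divisor of `P`
    have hirr : ∀ u ∈ nf, Irreducible u := fun u hu ↦
      UniqueFactorizationMonoid.irreducible_of_normalized_factor u (Multiset.mem_toFinset.1 hu)
    have hne0 : ∀ u ∈ nf, equivMvPolynomial K u ≠ 0 := fun u hu ↦
      (EmbeddingLike.map_ne_zero_iff).2 (hirr u hu).ne_zero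
    -- `m · T u₀ ≤ ∑ T u = T (∏ u) ≤ T P ≤ δ`
    have hprod : (∏ u ∈ nf, equivMvPolynomial K u) = equivMvPolynomial K (∏ u ∈ nf, u) :=
      (map_prod (equivMvPolynomial K) (fun u ↦ u) nf).symm
    have hdvdg : equivMvPolynomial K (∏ u ∈ nf, u) ∣ g := by
      rw [← hPg, hnf]
      exact map_dvd (equivMvPolynomial K) (prod_normalizedFactors_toFinset_dvd hP0)
    have hsumT : m * T u₀ ≤ δ := by
      calc m * T u₀ = ∑ _u ∈ nf, T u₀ := by rw [Finset.sum_const, smul_eq_mul, hm]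
        _ ≤ ∑ u ∈ nf, T u := Finset.sum_le_sum fun u hu ↦ hmin u hu
        _ = (∏ u ∈ nf, equivMvPolynomial K u).totalDegree :=
            sum_totalDegree_eq_totalDegree_prod nf _ hne0
        _ = (equivMvPolynomial K (∏ u ∈ nf, u)).totalDegree := by rw [hprod]
        _ ≤ g.totalDegree := totalDegree_le_of_dvd_of_isDomain hdvdg hg0
        _ ≤ δ := hdeg
    -- the divisor `H = image of u₀` of `G`
    set H : MvPolynomial (Fin 2) Kb := MvPolynomial.map ι (equivMvPolynomial K u₀) with hH
    have hHdvd : H ∣ G := by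
      have h1 : u₀ ∣ P :=
        UniqueFactorizationMonoid.dvd_of_mem_normalizedFactors (Multiset.mem_toFinset.1 hu₀)
      have h2 : equivMvPolynomial K u₀ ∣ g := by
        have h := map_dvd (equivMvPolynomial K) h1
        rwa [hPg] at h
      exact map_dvd (MvPolynomial.map ι) h2
    have hHT : H.totalDegree = T u₀ := totalDegree_map_of_injective _ ι.injective
    have hHu : ¬ IsUnit H := by
      refine not_isUnit_of_totalDegree_pos ?_
      rw [hHT]
      exact totalDegree_pos_of_not_isUnit (hne0 u₀ hu₀)
        (fun hu ↦ (hirr u₀ hu₀).not_isUnit ((MulEquiv.isUnit_map (equivMvPolynomial K)).1 hu))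
    -- `Icc 1 (m-1) ⊆ S`
    have hsub : Finset.Icc 1 (m - 1) ⊆ S := by
      intro j hj
      rw [Finset.mem_Icc] at hj
      refine hmemS hj.1 hHdvd hHu ?_
      rw [hHT]
      calc (j + 1) * T u₀ ≤ m * T u₀ := Nat.mul_le_mul_right _ (by omega)
        _ ≤ δ := hsumT
    have := Finset.card_le_card hsub
    rw [Nat.card_Icc] at this
    omega
  -- ### conclusion
  have hq0 : (0 : ℝ) ≤ q := Nat.cast_nonneg _
  have hN0 : (0 : ℝ) ≤ rationalPointCount g := Nat.cast_nonneg _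
  have hmS' : (m : ℝ) ≤ S.card + 1 := by exact_mod_cast hmS
  have hS1 : (1 : ℝ) ≤ S.card := by exact_mod_cast hScard
  have hsq : (0 : ℝ) ≤ ((δ - 1) * (δ - 2) : ℕ) * √(q : ℝ) := by positivity
  have hδ3 : (δ : ℝ) ^ 3 ≤ 1 + δ + 4 * (δ : ℝ) ^ 3 := by
    have : (0 : ℝ) ≤ δ := Nat.cast_nonneg _
    nlinarith [pow_nonneg this 3]
  have hδ0 : (0 : ℝ) ≤ δ := Nat.cast_nonneg _
  have hW0 : (0 : ℝ) ≤ ((δ - 1) * (δ - 2) : ℕ) * √(q : ℝ) + 1 + δ + 4 * (δ : ℝ) ^ 3 := by positivity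
  have hqS : (q : ℝ) ≤ q * S.card := by nlinarith
  have hmq : (m : ℝ) * q ≤ (S.card + 1) * q := mul_le_mul_of_nonneg_right hmS' hq0
  rw [abs_le]
  constructor
  · linarith
  · linarith

end OneSection

/-! ### The graded estimate for one parameter -/

section OneParam

variable [Fintype K] {m : ℕ}

/-- **The error of one plane section, graded.** For `f` of degree `δ` with `2 ≤ δ < q` and any
parameter `p = (ν, ω, η)`:
`|N(f_p) - q| ≤ W + [f_p = 0] q² + q · #{j ∈ [1, δ-1] : f_p not abs. irreducible and p is
⌊δ/(j+1)⌋-bad}`, where `p` is `D`-bad unless `f_p` is non-constant and every divisor of its image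
in `K̄[x₀, x₁]` of total degree `≤ D` is a unit; `W = (δ-1)(δ-2)√q + 1 + δ + 4δ³`.
[cite: CafureMatera2006, §4 and §5.1 (proof of Thm. 5.2)] -/
theorem abs_sub_le_planeSection_graded {f : MvPolynomial (Fin (m + 1)) K} {δ : ℕ} (hδ2 : 2 ≤ δ)
    (hdeg : f.totalDegree = δ) (hq : δ < Fintype.card K) (ν : Fin (m + 1) → K) (ω η : Fin m → K) :
    |(rationalPointCount (planeSection f ν ω η) : ℝ) - Fintype.card K| ≤
      (((δ - 1) * (δ - 2) : ℕ) * √(Fintype.card K : ℝ) + 1 + δ + 4 * (δ : ℝ) ^ 3) +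
        (if planeSection f ν ω η = 0 then (Fintype.card K : ℝ) ^ 2 else 0) +
        Fintype.card K * (((Finset.Icc 1 (δ - 1)).filter fun j ↦
          ¬ Irreducible (MvPolynomial.map (algebraMap K (AlgebraicClosure K))
              (planeSection f ν ω η)) ∧
            ¬ (0 < (planeSection f ν ω η).totalDegree ∧
                ∀ H : MvPolynomial (Fin 2) (AlgebraicClosure K),
                  H ∣ MvPolynomial.map (algebraMap K (AlgebraicClosure K)) (planeSection f ν ω η) →
                    H.totalDegree ≤ δ / (j + 1) → IsUnit H)).card : ℝ) := by
  set g := planeSection f ν ω η with hg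
  set q : ℕ := Fintype.card K with hq'
  set W : ℝ := ((δ - 1) * (δ - 2) : ℕ) * √(q : ℝ) + 1 + δ + 4 * (δ : ℝ) ^ 3 with hW
  set S : Finset ℕ := (Finset.Icc 1 (δ - 1)).filter fun j ↦
    ¬ Irreducible (MvPolynomial.map (algebraMap K (AlgebraicClosure K)) g) ∧
      ¬ (0 < g.totalDegree ∧ ∀ H : MvPolynomial (Fin 2) (AlgebraicClosure K),
        H ∣ MvPolynomial.map (algebraMap K (AlgebraicClosure K)) g →
          H.totalDegree ≤ δ / (j + 1) → IsUnit H) with hS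
  have hW0 : 0 ≤ W := by rw [hW]; positivity
  have hq0 : (0 : ℝ) ≤ q := Nat.cast_nonneg _
  have hq1 : (1 : ℝ) ≤ q := by exact_mod_cast Fintype.card_pos
  have hS0 : (0 : ℝ) ≤ q * (S.card : ℝ) := by positivity
  have hgdeg : g.totalDegree ≤ δ := hdeg ▸ totalDegree_planeSection_le f ν ω η
  by_cases h0 : g = 0
  · -- the section vanishes: `N = q²`
    rw [if_pos h0]
    have hN : (rationalPointCount g : ℝ) = (q : ℝ) ^ 2 := by
      rw [h0, rationalPointCount_zero_two, hq']; push_cast; rfl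
    have hqq : (q : ℝ) ≤ (q : ℝ) ^ 2 := by nlinarith
    rw [hN, abs_le]
    constructor <;> nlinarith
  rw [if_neg h0, add_zero]
  by_cases hirr : Irreducible (MvPolynomial.map (algebraMap K (AlgebraicClosure K)) g)
  · -- absolutely irreducible: Weil
    have := abs_sub_le_of_irreducible_map hirr hgdeg hq
    exact this.trans (le_add_of_nonneg_right hS0)
  by_cases hpos : 0 < g.totalDegree
  · -- non-constant and reducible over `K̄`: the graded bound
    have h := abs_sub_le_of_not_irreducible hδ2 hgdeg hpos hirr
    refine h.trans (add_le_add le_rfl (mul_le_mul_of_nonneg_left ?_ hq0))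
    exact_mod_cast Finset.card_le_card fun j hj ↦ by
      rw [Finset.mem_filter] at hj ⊢
      obtain ⟨hj1, H, hH, hHdeg, hHu⟩ := hj
      exact ⟨hj1, hirr, fun h2 ↦ hHu (h2.2 H hH hHdeg)⟩
  · -- a nonzero constant: no zeros, and every `j` is counted
    have hN : rationalPointCount g = 0 := by
      rw [not_lt, Nat.le_zero, totalDegree_eq_zero_iff_eq_C] at hpos
      have hc : g.coeff 0 ≠ 0 := fun hc ↦ h0 (by rw [hpos, hc, MvPolynomial.C_0])
      unfold rationalPointCount
      rw [Finset.card_eq_zero, Finset.filter_eq_empty_iff]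
      intro x _
      rw [hpos, MvPolynomial.eval_C]
      exact hc
    have hSall : S = Finset.Icc 1 (δ - 1) := by
      rw [hS]
      refine Finset.filter_true_of_mem fun j _ ↦ ⟨hirr, fun h2 ↦ hpos h2.1⟩
    have hScard : ((δ : ℝ) - 1) ≤ S.card := by
      rw [hSall, Nat.card_Icc, show δ - 1 + 1 - 1 = δ - 1 by omega]
      have h1 : 1 ≤ δ := by omega
      rw [Nat.cast_sub h1, Nat.cast_one]
    rw [hN, Nat.cast_zero, zero_sub, abs_neg, Nat.abs_cast]
    have hδ2' : (2 : ℝ) ≤ δ := by exact_mod_cast hδ2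
    nlinarith [mul_le_mul_of_nonneg_left hScard hq0]

end OneParam

/-! ### Summation over the parameters -/

section Sum

variable [Fintype K] {m : ℕ}

/-- **The refined averaging estimate (Cafure–Matera 2006, (21)–(22), graded form).** Let
`K = 𝔽_q`, `f ∈ K[x₀, …, xₘ]` (`m ≥ 1`) absolutely irreducible of total degree `δ` with
`2 ≤ δ < q`, `N` its number of zeros in `K^{m+1}`. For `j = 1, …, δ-1` let `B_j` be the number of
parameters `(ν, ω, η) ∈ K^{m+1} × Kᵐ × Kᵐ` whose plane section is not absolutely irreducible and
is `⌊δ/(j+1)⌋`-bad. Then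
`q^{m+2}(qᵐ - 1)|N - qᵐ| ≤ qᵐ(qᵐ - 1)q^{m+1} W + δ² q^{3m-1} q² + q ∑_{j=1}^{δ-1} B_j`,
`W = (δ-1)(δ-2)√q + 1 + δ + 4δ³`. [cite: CafureMatera2006, §5.1 (21)–(22) and Prop. 4.1] -/
theorem mul_abs_sub_le_graded (hm : 1 ≤ m) {f : MvPolynomial (Fin (m + 1)) K}
    (hf : IsAbsIrreducible f) {δ : ℕ} (hδ2 : 2 ≤ δ) (hdeg : f.totalDegree = δ)
    (hq : δ < Fintype.card K) :
    (Fintype.card K : ℝ) ^ (m + 2) * ((Fintype.card K : ℝ) ^ m - 1) *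
        |(rationalPointCount f : ℝ) - (Fintype.card K : ℝ) ^ m| ≤
      (Fintype.card K : ℝ) ^ m * ((Fintype.card K : ℝ) ^ m - 1) * (Fintype.card K : ℝ) ^ (m + 1) *
          (((δ - 1) * (δ - 2) : ℕ) * √(Fintype.card K : ℝ) + 1 + δ + 4 * (δ : ℝ) ^ 3) +
        (δ : ℝ) ^ 2 * (Fintype.card K : ℝ) ^ (3 * m - 1) * (Fintype.card K : ℝ) ^ 2 +
        Fintype.card K * ∑ j ∈ Finset.Icc 1 (δ - 1),
          (((Finset.univ : Finset ((Fin (m + 1) → K) × (Fin m → K) × (Fin m → K))).filter fun p ↦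
            ¬ Irreducible (MvPolynomial.map (algebraMap K (AlgebraicClosure K))
                (planeSection f p.1 p.2.1 p.2.2)) ∧
              ¬ (0 < (planeSection f p.1 p.2.1 p.2.2).totalDegree ∧
                  ∀ H : MvPolynomial (Fin 2) (AlgebraicClosure K),
                    H ∣ MvPolynomial.map (algebraMap K (AlgebraicClosure K))
                        (planeSection f p.1 p.2.1 p.2.2) →
                      H.totalDegree ≤ δ / (j + 1) → IsUnit H)).card : ℝ) := by
  set q : ℕ := Fintype.card K with hq'
  set P : Finset ((Fin (m + 1) → K) × (Fin m → K) × (Fin m → K)) :=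
    Finset.univ.filter fun p ↦ p.2.2 ≠ 0 with hP
  set Np : (Fin (m + 1) → K) × (Fin m → K) × (Fin m → K) → ℝ := fun p ↦
    (rationalPointCount (planeSection f p.1 p.2.1 p.2.2) : ℝ) with hNp
  set W : ℝ := ((δ - 1) * (δ - 2) : ℕ) * √(q : ℝ) + 1 + δ + 4 * (δ : ℝ) ^ 3 with hW
  -- the graded badness predicate
  set Bad : ℕ → (Fin (m + 1) → K) × (Fin m → K) × (Fin m → K) → Prop := fun j p ↦
    ¬ Irreducible (MvPolynomial.map (algebraMap K (AlgebraicClosure K))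
        (planeSection f p.1 p.2.1 p.2.2)) ∧
      ¬ (0 < (planeSection f p.1 p.2.1 p.2.2).totalDegree ∧
          ∀ H : MvPolynomial (Fin 2) (AlgebraicClosure K),
            H ∣ MvPolynomial.map (algebraMap K (AlgebraicClosure K))
                (planeSection f p.1 p.2.1 p.2.2) →
              H.totalDegree ≤ δ / (j + 1) → IsUnit H) with hBad
  have hirrK : Irreducible f := irreducible_of_irreducible_map (algebraMap K (AlgebraicClosure K)) hf
  -- the averaging identity
  have hsumN : ∑ p ∈ P, Np p = (q : ℝ) ^ m * ((q : ℝ) ^ m - 1) * ((q : ℝ) ^ 2 * rationalPointCount f) := by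
    rw [hNp, hP, ← sum_filter_rationalPointCount_planeSection f]
    push_cast
    rfl
  have hcardP : (P.card : ℝ) = (q : ℝ) ^ m * ((q : ℝ) ^ m - 1) * (q : ℝ) ^ (m + 1) := card_filter_ne_zero
  have hident : ∑ p ∈ P, (Np p - q) =
      (q : ℝ) ^ (m + 2) * ((q : ℝ) ^ m - 1) * ((rationalPointCount f : ℝ) - (q : ℝ) ^ m) := by
    rw [Finset.sum_sub_distrib, hsumN, Finset.sum_const, nsmul_eq_mul, hcardP]
    ring
  -- the per-parameter bound
  have hper : ∀ p ∈ P, |Np p - q| ≤ W +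
      (if planeSection f p.1 p.2.1 p.2.2 = 0 then (q : ℝ) ^ 2 else 0) +
      q * (((Finset.Icc 1 (δ - 1)).filter fun j ↦ Bad j p).card : ℝ) :=
    fun p _ ↦ abs_sub_le_planeSection_graded hδ2 hdeg hq p.1 p.2.1 p.2.2
  -- `#{j : Bad j p}` as a sum of indicators, and the double sum swapped
  have hcard_sum : ∀ p, ((((Finset.Icc 1 (δ - 1)).filter fun j ↦ Bad j p).card : ℕ) : ℝ) =
      ∑ j ∈ Finset.Icc 1 (δ - 1), (if Bad j p then (1 : ℝ) else 0) := fun p ↦ by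
    rw [Finset.card_filter]; push_cast; rfl
  have hswap : ∑ p ∈ P, (q : ℝ) * (((Finset.Icc 1 (δ - 1)).filter fun j ↦ Bad j p).card : ℝ) ≤
      q * ∑ j ∈ Finset.Icc 1 (δ - 1),
        (((Finset.univ : Finset ((Fin (m + 1) → K) × (Fin m → K) × (Fin m → K))).filter
          fun p ↦ Bad j p).card : ℝ) := by
    rw [← Finset.mul_sum]
    refine mul_le_mul_of_nonneg_left ?_ (Nat.cast_nonneg _)
    calc ∑ p ∈ P, ((((Finset.Icc 1 (δ - 1)).filter fun j ↦ Bad j p).card : ℕ) : ℝ)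
        ≤ ∑ p : (Fin (m + 1) → K) × (Fin m → K) × (Fin m → K),
            ((((Finset.Icc 1 (δ - 1)).filter fun j ↦ Bad j p).card : ℕ) : ℝ) :=
          Finset.sum_le_sum_of_subset_of_nonneg (Finset.filter_subset _ _)
            (fun p _ _ ↦ Nat.cast_nonneg _)
      _ = ∑ j ∈ Finset.Icc 1 (δ - 1), ∑ p : (Fin (m + 1) → K) × (Fin m → K) × (Fin m → K),
            (if Bad j p then (1 : ℝ) else 0) := by
          simp_rw [hcard_sum]
          exact Finset.sum_comm
      _ = ∑ j ∈ Finset.Icc 1 (δ - 1),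
            (((Finset.univ : Finset ((Fin (m + 1) → K) × (Fin m → K) × (Fin m → K))).filter
              fun p ↦ Bad j p).card : ℝ) := by
          refine Finset.sum_congr rfl fun j _ ↦ ?_
          rw [Finset.card_filter]; push_cast; rfl
  have hsum_le : ∑ p ∈ P, |Np p - q| ≤ P.card * W +
      (q : ℝ) ^ 2 * ((Finset.univ : Finset ((Fin (m + 1) → K) × (Fin m → K) × (Fin m → K))).filter
        fun p ↦ planeSection f p.1 p.2.1 p.2.2 = 0).card +
      q * ∑ j ∈ Finset.Icc 1 (δ - 1),
        (((Finset.univ : Finset ((Fin (m + 1) → K) × (Fin m → K) × (Fin m → K))).filter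
          fun p ↦ Bad j p).card : ℝ) := by
    refine (Finset.sum_le_sum hper).trans ?_
    rw [Finset.sum_add_distrib, Finset.sum_add_distrib, Finset.sum_const, nsmul_eq_mul]
    refine add_le_add (add_le_add le_rfl ?_) hswap
    rw [← Finset.sum_filter, Finset.sum_const, nsmul_eq_mul, mul_comm]
    refine mul_le_mul_of_nonneg_left ?_ (by positivity)
    exact_mod_cast Finset.card_le_card (Finset.filter_subset_filter _ (Finset.filter_subset _ _))
  -- the vanishing sections
  have hZ : (((Finset.univ : Finset ((Fin (m + 1) → K) × (Fin m → K) × (Fin m → K))).filter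
      fun p ↦ planeSection f p.1 p.2.1 p.2.2 = 0).card : ℝ) ≤ (δ : ℝ) ^ 2 * (q : ℝ) ^ (3 * m - 1) := by
    exact_mod_cast card_filter_planeSection_eq_zero_le' hm hirrK hδ2 hdeg
  -- conclusion
  rw [← abs_of_nonneg (show (0 : ℝ) ≤ (q : ℝ) ^ (m + 2) * ((q : ℝ) ^ m - 1) by
    have h1 : (1 : ℝ) ≤ (q : ℝ) ^ m := one_le_pow₀ (by exact_mod_cast Fintype.card_pos)
    have : (0 : ℝ) ≤ (q : ℝ) ^ (m + 2) := by positivity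
    nlinarith), ← abs_mul, ← hident]
  refine (Finset.abs_sum_le_sum_abs _ _).trans (hsum_le.trans ?_)
  rw [hcardP]
  have hq2 : (0 : ℝ) ≤ (q : ℝ) ^ 2 := by positivity
  nlinarith [mul_le_mul_of_nonneg_left hZ hq2]

end Sum

end Literature.NumberTheory.DiophantineGeometry

end
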